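import Literature.Topology.FourManifolds.HandleModelField
import HarnessLib

/-!
# Handle charts: a Morse chart in which the vector field is the normalised Milnor model field

Topic `Literature/Topology/FourManifolds` (fact seat
`provefact-Literature.Topology.FourManifolds.IsHandlebody.exists_isBoundaryGluing_sphere`, step F2b of
the Lickorish–Wallace DAG; chart layer of the handle-extension step of the classification of
handlebodies).  Everything here is **proved**; no named facts.

A **handle chart** about a critical point `p` of `f` for the vector field `X`
(`Literature.Topology.FourManifolds.HandleChart J f X p`) is a chart `φ` of the `C^∞` maximal
atlas about `p`, an index `k` and a core radius `r > 0` such that on `φ.source`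
`f = f p + Q_k(u)` (`Q_k = milnorQuadratic k`, `u = φ̂ - φ̂ p`) and `dφ̂(X) = Ê_{k,r}(u)`, the
normalised Milnor model field of `HandleModelField.lean` (Milnor's `(-x⃗, y⃗)` for `‖u‖ ≤ r`,
unit speed `X(f) = 1` for `‖u‖ ≥ 2r`).  This is the tree's `Literature.Topology.FourManifolds.MilnorBox`
(`GradientLikeDynamics.lean`, Milnor 1965, Def. 3.1 (2)) with the field renormalised off the
core, so that two manifolds compared through their handle charts carry the *same* field in
coordinates.  Contents:

* `HandleChart.mlineDeriv_eq` — `X(f) = g_r(u) · 2‖u‖²` on the chart domain; `= 1` off the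
  core (`mlineDeriv_eq_one`), `> 0` off `p` (`mlineDeriv_pos`);
* `IsFlowOf.hasDerivAt_coord_handleChart` — along an orbit of a global flow of `X` inside the
  chart domain, `du/dt = Ê(u)`; hence `d(|x⃗|²|y⃗|²)/dt = 0` (`hasDerivAt_sqSumLT_mul_sqSumGE`) and
  **`|x⃗|²|y⃗|²` is constant on orbit segments inside the chart domain**
  (`sqSumLT_mul_sqSumGE_eq_of_forall_mem`; Milnor, proof of Thm. 3.12: the trajectories are
  `(t x⃗, t⁻¹ y⃗)`), and `df/dt = X(f)` (`hasDerivAt_apply_handleChart`);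
* `Literature.Topology.FourManifolds.handlePullback φ p k r` — the field `φ̂^* Ê(· - φ̂ p)` on
  `φ.source` (Mathlib's `VectorField.mpullback`, as in `IsMorse.exists_local_gradientLike`):
  smooth on `φ.source`, with `dφ̂ = Ê(u)` and the same speed formula — the local datum from which
  a global `X` making `φ` a handle chart is produced by `PrescribedUnitField.lean`.

## References

* J. Milnor, *Lectures on the h-cobordism theorem* (1965), Def. 3.1, proofs of Lemma 3.2,
  Thm. 3.4 and Thm. 3.12 (PDF pp. 12, 13, 18). [MilnorHCobordism1965]
-/

open scoped Manifold ContDiff Topology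
open Set Function Filter Metric

noncomputable section

namespace Literature.Topology.FourManifolds

universe u

variable {m : ℕ} {H : Type*} [TopologicalSpace H] {J : ModelWithCorners ℝ (EuclideanSpace ℝ (Fin m)) H}
  {M : Type u} [TopologicalSpace M] [ChartedSpace H M]

/-- Local notation: `𝔼 m` is the model Euclidean space `EuclideanSpace ℝ (Fin m)`. -/
local notation "𝔼 " m:arg => EuclideanSpace ℝ (Fin m)

variable (J) in
/-- **A handle chart about the critical point `p`** for `f` and the vector field `X`: a chart
`φ` of the maximal atlas about `p`, an index `k` and a core radius `r > 0` with, on `φ.source`,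
`f = f p + Q_k(φ̂ - φ̂ p)` and `dφ̂(X) = Ê_{k,r}(φ̂ - φ̂ p)` (the normalised Milnor model field).
Milnor 1965, Def. 3.1 (2), with the field rescaled to unit speed off the core (proof of
Thm. 3.4). [cite: MilnorHCobordism1965, Def. 3.1 and proof of Thm. 3.4 (PDF p. 13)] -/
structure HandleChart (f : M → ℝ) (X : Π x : M, TangentSpace J x) (p : M) where
  /-- The chart. -/
  chart : OpenPartialHomeomorph M H
  /-- The index of the normal form. -/
  k : ℕ
  /-- The core radius. -/
  r : ℝ
  r_pos : 0 < r
  mem_maximalAtlas : chart ∈ IsManifold.maximalAtlas J ∞ M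
  mem_source : p ∈ chart.source
  apply_eq : ∀ q ∈ chart.source,
    f q = f p + milnorQuadratic k (chart.extend J q - chart.extend J p)
  mfderiv_eq : ∀ q ∈ chart.source, mfderiv J 𝓘(ℝ, 𝔼 m) (chart.extend J) q (X q) =
    handleModelField k r_pos (chart.extend J q - chart.extend J p)

namespace HandleChart

variable {f : M → ℝ} {X : Π x : M, TangentSpace J x} {p : M} (D : HandleChart J f X p)

/-- The centred coordinates `u = φ̂ q - φ̂ p`. [cite: MilnorHCobordism1965, Def. 3.1] -/
def coord (q : M) : 𝔼 m := D.chart.extend J q - D.chart.extend J p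

/-- The coordinates of the centre vanish. [folklore] -/
@[simp] theorem coord_self : D.coord p = 0 := sub_self _

/-- The coordinates vanish only at the centre (on the chart domain). [folklore] -/
theorem coord_ne_zero {q : M} (hq : q ∈ D.chart.source) (hqp : q ≠ p) : D.coord q ≠ 0 := by
  intro h0
  apply hqp
  have h' : D.chart.extend J q = D.chart.extend J p := sub_eq_zero.1 h0
  exact (D.chart.extend J).injOn (by rwa [D.chart.extend_source]) (by
    rw [D.chart.extend_source]; exact D.mem_source) h'

/-- The coordinates are continuous on the chart domain. [folklore] -/
theorem continuousOn_coord : ContinuousOn D.coord D.chart.source := by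
  have h := D.chart.continuousOn_extend (I := J)
  rw [D.chart.extend_source] at h
  exact h.sub continuousOn_const

/-- **The speed of the field in a handle chart**: `X(f)(q) = g_r(u) · 2‖u‖²`, `u = coord q`
(chain rule through the chart and `fderiv_milnorQuadratic_handleModelField`).
[cite: MilnorHCobordism1965, proof of Lemma 3.2 (PDF p. 12) and of Thm. 3.4 (PDF p. 13)] -/
theorem mlineDeriv_eq {q : M} (hq : q ∈ D.chart.source) :
    mlineDeriv J f q (X q) = speedFactor D.r_pos (D.coord q) * (2 * ‖D.coord q‖ ^ 2) := by
  set u₀ : 𝔼 m := D.chart.extend J p with hu₀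
  set g : 𝔼 m → ℝ := fun u => f p + milnorQuadratic D.k (u - u₀) with hg
  have hfg : ∀ q' ∈ D.chart.source, f q' = g (D.chart.extend J q') := fun q' hq' => D.apply_eq q' hq'
  have hgd : HasFDerivAt g (fderiv ℝ (milnorQuadratic (m := m) D.k) (D.chart.extend J q - u₀))
      (D.chart.extend J q) := by
    have h1 := (hasFDerivAt_milnorQuadratic (m := m) D.k (D.chart.extend J q - u₀))
    have h2 : HasFDerivAt (fun u : 𝔼 m => u - u₀) (ContinuousLinearMap.id ℝ (𝔼 m))
        (D.chart.extend J q) := (hasFDerivAt_id _).sub_const u₀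
    have h3 := h1.comp (D.chart.extend J q) h2
    rw [ContinuousLinearMap.comp_id] at h3
    rw [h1.fderiv]
    exact h3.const_add (f p)
  rw [mlineDeriv_def, mfderiv_apply_of_eq_comp_extend D.mem_maximalAtlas hq hgd hfg,
    D.mfderiv_eq q hq]
  exact fderiv_milnorQuadratic_handleModelField D.k D.r_pos _

/-- **Unit speed off the core**: `X(f)(q) = 1` when `2r ≤ ‖coord q‖`. [cite: MilnorHCobordism1965, proof of Thm. 3.4 (PDF p. 13)] -/
theorem mlineDeriv_eq_one {q : M} (hq : q ∈ D.chart.source) (h2r : 2 * D.r ≤ ‖D.coord q‖) :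
    mlineDeriv J f q (X q) = 1 := by
  rw [D.mlineDeriv_eq hq, ← fderiv_milnorQuadratic_handleModelField]
  exact fderiv_milnorQuadratic_handleModelField_eq_one D.k D.r_pos h2r

/-- **Positive speed off the centre.** [cite: MilnorHCobordism1965, Def. 3.1 (1)] -/
theorem mlineDeriv_pos {q : M} (hq : q ∈ D.chart.source) (hqp : q ≠ p) :
    0 < mlineDeriv J f q (X q) := by
  rw [D.mlineDeriv_eq hq, ← fderiv_milnorQuadratic_handleModelField]
  exact fderiv_milnorQuadratic_handleModelField_pos D.k D.r_pos (D.coord_ne_zero hq hqp)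

/-- The speed is nonnegative on the chart domain. [folklore] -/
theorem mlineDeriv_nonneg {q : M} (hq : q ∈ D.chart.source) : 0 ≤ mlineDeriv J f q (X q) := by
  rw [D.mlineDeriv_eq hq, ← fderiv_milnorQuadratic_handleModelField]
  exact fderiv_milnorQuadratic_handleModelField_nonneg D.k D.r_pos _

end HandleChart

/-! ### Orbits of a global flow inside a handle chart -/

section Orbits

variable {f : M → ℝ} {X : Π x : M, TangentSpace J x} {θ : ℝ × M → M} {p : M}

set_option backward.isDefEq.respectTransparency false in
/-- **The coordinates of an orbit solve the normalised model equation**: while `θ(s, z)` is in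
the chart domain, `d/ds u(θ(s, z)) = Ê(u(θ(s, z)))` (as for `IsFlowOf.hasDerivAt_coord`).
[cite: MilnorHCobordism1965, Def. 3.1 and proof of Thm. 3.12] -/
theorem IsFlowOf.hasDerivAt_coord_handleChart (h : IsFlowOf J X θ) (D : HandleChart J f X p) {z : M}
    {s : ℝ} (hs : θ (s, z) ∈ D.chart.source) :
    HasDerivAt (fun t => D.coord (θ (t, z)))
      (handleModelField D.k D.r_pos (D.coord (θ (s, z)))) s := by
  have hγ : HasMFDerivAt 𝓘(ℝ, ℝ) J (fun t => θ (t, z)) s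
      ((1 : ℝ →L[ℝ] ℝ).smulRight (X (θ (s, z)))) := h.isMIntegralCurve z s
  have hφ : HasMFDerivAt J 𝓘(ℝ, 𝔼 m) (D.chart.extend J) (θ (s, z))
      (mfderiv J 𝓘(ℝ, 𝔼 m) (D.chart.extend J) (θ (s, z))) :=
    (mdifferentiableAt_extend_of_mem_maximalAtlas D.mem_maximalAtlas hs).hasMFDerivAt
  have h1 : HasMFDerivAt 𝓘(ℝ, ℝ) 𝓘(ℝ, 𝔼 m) (D.chart.extend J ∘ fun t => θ (t, z)) s
      ((mfderiv J 𝓘(ℝ, 𝔼 m) (D.chart.extend J) (θ (s, z))).comp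
        ((1 : ℝ →L[ℝ] ℝ).smulRight (X (θ (s, z))))) := hφ.comp s hγ
  have h2 : HasFDerivAt (D.chart.extend J ∘ fun t => θ (t, z))
      ((mfderiv J 𝓘(ℝ, 𝔼 m) (D.chart.extend J) (θ (s, z))).comp
        ((1 : ℝ →L[ℝ] ℝ).smulRight (X (θ (s, z))))) s :=
    hasMFDerivAt_iff_hasFDerivAt.1 h1
  have h3 : ((mfderiv J 𝓘(ℝ, 𝔼 m) (D.chart.extend J) (θ (s, z))).comp
        ((1 : ℝ →L[ℝ] ℝ).smulRight (X (θ (s, z)))) : ℝ →L[ℝ] 𝔼 m) =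
      (1 : ℝ →L[ℝ] ℝ).smulRight (handleModelField D.k D.r_pos (D.coord (θ (s, z)))) := by
    apply ContinuousLinearMap.ext_ring
    show (mfderiv J 𝓘(ℝ, 𝔼 m) (D.chart.extend J) (θ (s, z))) (((1 : ℝ →L[ℝ] ℝ) (1 : ℝ)) • X (θ (s, z))) =
      ((1 : ℝ →L[ℝ] ℝ) (1 : ℝ)) • handleModelField D.k D.r_pos (D.coord (θ (s, z)))
    rw [map_smul, D.mfderiv_eq _ hs]
    rfl
  have h4 : HasDerivAt (D.chart.extend J ∘ fun t => θ (t, z))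
      (handleModelField D.k D.r_pos (D.coord (θ (s, z)))) s :=
    hasDerivAt_iff_hasFDerivAt.2 (h2.congr_fderiv h3)
  exact h4.sub_const _

/-- **`|x⃗|²|y⃗|²` has zero derivative along orbits inside a handle chart.** [cite: MilnorHCobordism1965, proof of Thm. 3.12 (PDF p. 18)] -/
theorem IsFlowOf.hasDerivAt_sqSumLT_mul_sqSumGE (h : IsFlowOf J X θ) (D : HandleChart J f X p)
    {z : M} {s : ℝ} (hs : θ (s, z) ∈ D.chart.source) :
    HasDerivAt (fun t => sqSumLT D.k (D.coord (θ (t, z))) * sqSumGE D.k (D.coord (θ (t, z)))) 0 s := by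
  have hAB : HasFDerivAt (fun v : 𝔼 m => sqSumLT (m := m) D.k v * sqSumGE D.k v)
      (fderiv ℝ (fun v : 𝔼 m => sqSumLT (m := m) D.k v * sqSumGE D.k v) (D.coord (θ (s, z))))
      (D.coord (θ (s, z))) :=
    ((((contDiff_sqSumLT (m := m) D.k).mul (contDiff_sqSumGE D.k)).differentiable (by simp))
      _).hasFDerivAt
  have h1 := hAB.comp_hasDerivAt s (h.hasDerivAt_coord_handleChart D hs)
  rw [fderiv_sqSumLT_mul_sqSumGE_handleModelField] at h1
  exact h1

/-- **Conservation of `|x⃗|²|y⃗|²` on orbit segments inside a handle chart**: if `θ(t, z)` stays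
in the chart domain for `t ∈ [t₁, t₂]`, the product of the squared coordinate radii is the same
at both ends (Milnor, proof of Thm. 3.12: the trajectories are `(t x⃗, t⁻¹ y⃗)`).
[cite: MilnorHCobordism1965, proof of Thm. 3.12 (PDF p. 18)] -/
theorem IsFlowOf.sqSumLT_mul_sqSumGE_eq_of_forall_mem (h : IsFlowOf J X θ) (D : HandleChart J f X p)
    {z : M} {t₁ t₂ : ℝ} (hmem : ∀ t ∈ Icc t₁ t₂, θ (t, z) ∈ D.chart.source)
    {t : ℝ} (ht : t ∈ Icc t₁ t₂) :
    sqSumLT D.k (D.coord (θ (t, z))) * sqSumGE D.k (D.coord (θ (t, z))) =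
      sqSumLT D.k (D.coord (θ (t₁, z))) * sqSumGE D.k (D.coord (θ (t₁, z))) := by
  have hderiv : ∀ x ∈ Icc t₁ t₂, HasDerivAt
      (fun t => sqSumLT D.k (D.coord (θ (t, z))) * sqSumGE D.k (D.coord (θ (t, z)))) 0 x :=
    fun x hx => h.hasDerivAt_sqSumLT_mul_sqSumGE D (hmem x hx)
  have hcont : ContinuousOn
      (fun t => sqSumLT D.k (D.coord (θ (t, z))) * sqSumGE D.k (D.coord (θ (t, z)))) (Icc t₁ t₂) :=
    fun x hx => (hderiv x hx).continuousAt.continuousWithinAt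
  exact constant_of_has_deriv_right_zero hcont
    (fun x hx => (hderiv x (Ico_subset_Icc_self hx)).hasDerivWithinAt) t ht

/-- **`df/dt = X(f)` along an orbit** (Milnor, proof of Thm. 3.4); inside a handle chart this is
`g_r(u) · 2‖u‖²`. [cite: MilnorHCobordism1965, proof of Thm. 3.4 (PDF p. 13)] -/
theorem IsFlowOf.hasDerivAt_apply_handleChart (h : IsFlowOf J X θ) (D : HandleChart J f X p)
    (hf : ContMDiff J 𝓘(ℝ, ℝ) ∞ f) {z : M} {s : ℝ} (hs : θ (s, z) ∈ D.chart.source) :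
    HasDerivAt (fun t => f (θ (t, z)))
      (speedFactor D.r_pos (D.coord (θ (s, z))) * (2 * ‖D.coord (θ (s, z))‖ ^ 2)) s := by
  rw [← D.mlineDeriv_eq hs]
  exact h.hasDerivAt_apply hf z s

end Orbits

/-! ### The local field of a Morse chart -/

section Pullback

variable [IsManifold J ∞ M]

/-- **The normalised model field pulled back along a chart**: `φ̂^* Ê_{k,r}(· - φ̂ p)` (Mathlib's
`VectorField.mpullback`; Milnor's "on `U₀` there is the vector field whose coordinates are
`(-x₁, …, x_n)`", here renormalised). [cite: MilnorHCobordism1965, proof of Lemma 3.2 (PDF p. 12)] -/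
def handlePullback (φ : OpenPartialHomeomorph M H) (p : M) (k : ℕ) {r : ℝ} (hr : 0 < r) :
    Π x : M, TangentSpace J x :=
  VectorField.mpullback J 𝓘(ℝ, 𝔼 m) (φ.extend J)
    (fun u => handleModelField k hr (u - φ.extend J p))

variable {φ : OpenPartialHomeomorph M H} (hφ : φ ∈ IsManifold.maximalAtlas J ∞ M) (p : M) (k : ℕ)
  {r : ℝ} (hr : 0 < r)

include hφ in
/-- The pulled-back field is smooth on the chart domain. [folklore] -/
theorem contMDiffOn_handlePullback :
    ContMDiffOn J J.tangent ∞
      (fun x => (⟨x, handlePullback (J := J) φ p k hr x⟩ : TangentBundle J M)) φ.source :=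
  contMDiffOn_mpullback_extend hφ
    ((contDiff_handleModelField k hr).comp (contDiff_id.sub contDiff_const))

include hφ in
omit [IsManifold J ∞ M] in
/-- The pulled-back field has the model coordinates: `dφ̂(φ̂^*Ê) = Ê(u)`. [folklore] -/
theorem mfderiv_extend_handlePullback {x : M} (hx : x ∈ φ.source) :
    mfderiv J 𝓘(ℝ, 𝔼 m) (φ.extend J) x (handlePullback (J := J) φ p k hr x) =
      handleModelField k hr (φ.extend J x - φ.extend J p) :=
  mfderiv_extend_mpullback hφ _ hx

/-- **A Morse chart with the pulled-back field is a handle chart** (for any global field `X`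
agreeing with `φ̂^*Ê` on the chart domain). [cite: MilnorHCobordism1965, Def. 3.1 and proof of Lemma 3.2] -/
def HandleChart.ofEqOn {f : M → ℝ} {X : Π x : M, TangentSpace J x} {p : M}
    (φ : OpenPartialHomeomorph M H) (hφ : φ ∈ IsManifold.maximalAtlas J ∞ M) (hp : p ∈ φ.source)
    (k : ℕ) {r : ℝ} (hr : 0 < r)
    (hfq : ∀ q ∈ φ.source, f q = f p + milnorQuadratic k (φ.extend J q - φ.extend J p))
    (hX : ∀ q ∈ φ.source, X q = handlePullback (J := J) φ p k hr q) : HandleChart J f X p where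
  chart := φ
  k := k
  r := r
  r_pos := hr
  mem_maximalAtlas := hφ
  mem_source := hp
  apply_eq := hfq
  mfderiv_eq q hq := by rw [hX q hq]; exact mfderiv_extend_handlePullback hφ p k hr hq

end Pullback

end Literature.Topology.FourManifolds
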